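import Literature.AlgebraicGeometry.Motives.AbelianVarietySimpleFactorsUnique
import Literature.AlgebraicGeometry.Motives.AbelianVarietyPoincareSplitting
import HarnessLib

/-!
# Equivariant homomorphisms and the uniqueness of the multiplicities with operators

The tree's `Motives/AbelianVarietySimpleFactorsUnique` proves the uniqueness half of Poincaré's
complete reducibility theorem («the `r_i` are uniquely determined and the `A_i` are uniquely
determined up to isogeny», Milne 1986 §12 p. 122) by counting `rank_ℤ Hom(X, B)` along a
decomposition up to isogeny.  This file does the same WITH OPERATORS — for abelian varieties with
an action `R →+* End` of a semiring `R` and EQUIVARIANT decompositions up to isogeny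
(`Motives/AbelianVarietyEquivariantQuasiDecomposition`): the group counted is
`Hom_R(X, B) = {f | φ r ≫ f = f ≫ β r}`, a subgroup of the finitely generated free abelian group
`Hom(X, B)`.

* `AbelianVariety.equivariantHom φ β : Submodule ℤ (X ⟶ B)` — the equivariant homomorphisms;
* `AbelianVariety.finrank_equivariantHom_eq_sum_of_quasiDecomposition` — along an equivariant
  decomposition `X ~ ⊕ Sᵢ` (equivariant `ιᵢ`, `πᵢ`, `ιᵢ πᵢ = N`, `ιᵢ πⱼ = 0`, `∑ πᵢ ιᵢ = N`),
  `rank_ℤ Hom_R(X, B) = ∑ᵢ rank_ℤ Hom_R(Sᵢ, B)`;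
* `AbelianVariety.equivariant_of_quasiInverse` — the quasi-inverse of an equivariant isogeny is
  equivariant; `AbelianVariety.finrank_equivariantHom_eq_of_isIsogeny_left` — `rank_ℤ Hom_R(−, B)`
  is invariant under equivariant isogenies;
* `AbelianVariety.finrank_equivariantHom_eq_card_mul` — **the equivariant Hom count**: granted
  that non-zero equivariant homomorphisms `Sᵢ → B` are isogenies (`hSB`: Schur's lemma with
  operators for `R`-simple `Sᵢ`, `B` — `Motives/AbelianVarietyEquivariantSchur`,
  `…KernelComponentAction`), `rank_ℤ Hom_R(X, B) = #{i : Sᵢ ∼_R B} · rank_ℤ End_R(B)`, where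
  `Sᵢ ∼_R B` means an EQUIVARIANT isogeny `Sᵢ → B`;
* `AbelianVariety.card_equivariantlyIsogenous_eq_of_quasiDecompositions` — **uniqueness of the
  multiplicities with operators**: two equivariant decompositions of equivariantly isogenous
  abelian varieties have the same number of pieces equivariantly isogenous to any given `B` of
  positive dimension; `AbelianVariety.exists_equivariantlyIsogenous_piece_of_quasiDecompositions` —
  every piece of positive dimension of the one is equivariantly isogenous to a piece of the other.

Everything is proved; the one `def` (`equivariantHom`, a `Submodule` with its carrier) is a
construction with a body; no named fact (D-0026).

## References

* J. S. Milne, *Abelian Varieties*, in Cornell–Silverman (eds.), *Arithmetic Geometry* (1986), §12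
  p. 122 (held copy `book:cornellnd-arithmetic-geometry`, PDF p. 189). [Milne1986AbelianVarieties]
* D. Mumford, *Abelian Varieties* (1970), §19 Thm. 1, Cor. 1–2 (pp. 173–174) and the remark
  p. 169 (quasi-inverses). [MumfordAV1970]
* H. Lange, R. E. Rodríguez, *Decomposition of Jacobians by Prym Varieties*, LNM 2310 (2022),
  §2.8–2.9 (isotypical decomposition; uniqueness of the `G`-simple pieces up to `G`-isogeny).
  [LangeRodriguez2022]
-/

noncomputable section

universe u v

open CategoryTheory CategoryTheory.Limits AlgebraicGeometry

namespace Literature.AlgebraicGeometry.Motives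

namespace AbelianVariety

variable {K : Type u} [Field K] {R : Type v} [Semiring R]

/-! ## §0 The group of equivariant homomorphisms -/

/-- **The equivariant homomorphisms** `Hom_R(X, B) = {f : X ⟶ B | φ r ≫ f = f ≫ β r ∀ r}` for
actions `φ : R →+* End X`, `β : R →+* End B`, as a subgroup (`ℤ`-submodule) of `Hom(X, B)`.
[cite: LangeRodriguez2022, §2.9] [cite: Milne1986AbelianVarieties, §12 p. 122 (PDF p. 189)] -/
def equivariantHom {X B : AbelianVariety K} (φ : R →+* End X) (β : R →+* End B) :
    Submodule ℤ (X ⟶ B) where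
  carrier := {f | ∀ r : R, End.asHom (φ r) ≫ f = f ≫ End.asHom (β r)}
  zero_mem' r := by
    change End.asHom (φ r) ≫ 0 = 0 ≫ End.asHom (β r)
    rw [comp_zero, zero_comp]
  add_mem' {f g} hf hg r := by
    change End.asHom (φ r) ≫ (f + g) = (f + g) ≫ End.asHom (β r)
    rw [Preadditive.comp_add, Preadditive.add_comp, hf r, hg r]
  smul_mem' n f hf r := by
    change End.asHom (φ r) ≫ (n • f) = (n • f) ≫ End.asHom (β r)
    rw [Preadditive.comp_zsmul, Preadditive.zsmul_comp, hf r]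

/-- Membership in `Hom_R(X, B)` is equivariance (unfolding of the definition).
[cite: LangeRodriguez2022, §2.9] -/
@[simp]
theorem mem_equivariantHom_iff {X B : AbelianVariety K} (φ : R →+* End X) (β : R →+* End B)
    (f : X ⟶ B) : f ∈ equivariantHom φ β ↔ ∀ r : R, End.asHom (φ r) ≫ f = f ≫ End.asHom (β r) :=
  Iff.rfl

/-- `Hom_R(X, B)` is a finitely generated abelian group (`Hom(X, B)` is, Mumford §19 Thm. 3).
[cite: MumfordAV1970, §19 Thm. 3] -/
instance equivariantHom.moduleFinite {X B : AbelianVariety K} (φ : R →+* End X)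
    (β : R →+* End B) : Module.Finite ℤ (equivariantHom φ β) := by
  haveI : Module.Finite ℤ (X ⟶ B) := module_finite_hom_holds X B
  infer_instance

/-- `Hom_R(X, B)` is torsion-free (`Hom(X, B)` is, Milne 1986 Lemma 12.2).
[cite: Milne1986AbelianVarieties, §12 Lemma 12.2 (PDF p. 189)] -/
instance equivariantHom.isTorsionFree {X B : AbelianVariety K} (φ : R →+* End X)
    (β : R →+* End B) : Module.IsTorsionFree ℤ (equivariantHom φ β) := by
  haveI : Module.IsTorsionFree ℤ (X ⟶ B) := isTorsionFree_int_hom X B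
  infer_instance

/-- Rank comparison along maps inverse to each other up to `N ≠ 0` between finitely generated
torsion-free abelian groups (both maps are injective). Private plumbing, as in
`Motives/AbelianVarietySimpleFactorsUnique`. [folklore] -/
private theorem finrank_eq_of_nsmul_inverse' {M M' : Type*} [AddCommGroup M] [AddCommGroup M']
    [Module.Finite ℤ M] [Module.Finite ℤ M'] [Module.IsTorsionFree ℤ M] [Module.IsTorsionFree ℤ M']
    (φ : M →+ M') (ψ : M' →+ M) {N : ℕ} (hN : N ≠ 0)
    (h₁ : ∀ x, ψ (φ x) = N • x) (h₂ : ∀ y, φ (ψ y) = N • y) :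
    Module.finrank ℤ M = Module.finrank ℤ M' := by
  have hNz : (N : ℤ) ≠ 0 := by exact_mod_cast hN
  have hφ : Function.Injective φ.toIntLinearMap := by
    intro x y hxy
    have h : (N : ℤ) • x = (N : ℤ) • y := by
      rw [natCast_zsmul, natCast_zsmul, ← h₁ x, ← h₁ y]
      exact congrArg ψ hxy
    exact smul_right_injective M hNz h
  have hψ : Function.Injective ψ.toIntLinearMap := by
    intro x y hxy
    have h : (N : ℤ) • x = (N : ℤ) • y := by
      rw [natCast_zsmul, natCast_zsmul, ← h₂ x, ← h₂ y]
      exact congrArg φ hxy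
    exact smul_right_injective M' hNz h
  exact le_antisymm (LinearMap.finrank_le_finrank_of_injective hφ)
    (LinearMap.finrank_le_finrank_of_injective hψ)

/-! ## §1 `Hom_R(−, B)` along an equivariant quasi-decomposition -/

section QuasiDecomposition

variable {X : AbelianVariety K} {I : Type} [Fintype I] {S : I → AbelianVariety K}
  (ι : ∀ i, S i ⟶ X) (π : ∀ i, X ⟶ S i) {N : ℕ}

/-- **`Hom_R(−, B)` is additive along an equivariant decomposition up to isogeny.** For an
equivariant decomposition `X ~ ⊕ Sᵢ` of `(X, φ)` into pieces `(Sᵢ, χᵢ)` (equivariant `ιᵢ`, `πᵢ`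
with `ιᵢ πᵢ = N`, `ιᵢ πⱼ = 0 (i ≠ j)`, `∑ πᵢ ιᵢ = N`) and any `(B, β)`,
`rank_ℤ Hom_R(X, B) = ∑ᵢ rank_ℤ Hom_R(Sᵢ, B)`: the maps `f ↦ (ιᵢ ≫ f)ᵢ` and `(gᵢ) ↦ ∑ πᵢ ≫ gᵢ`
preserve equivariance and are inverse to each other up to `N`.
[cite: Milne1986AbelianVarieties, §12 p. 122 (PDF p. 189)] [cite: LangeRodriguez2022, §2.9] -/
theorem finrank_equivariantHom_eq_sum_of_quasiDecomposition (φ : R →+* End X)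
    (χ : ∀ i, R →+* End (S i)) (hN : 0 < N)
    (h1 : ∀ i, ι i ≫ π i = N • 𝟙 (S i)) (h2 : ∀ i j, i ≠ j → ι i ≫ π j = 0)
    (h3 : ∑ i, π i ≫ ι i = N • 𝟙 X)
    (hι : ∀ i (r : R), ι i ≫ End.asHom (φ r) = End.asHom (χ i r) ≫ ι i)
    (hπ : ∀ i (r : R), End.asHom (φ r) ≫ π i = π i ≫ End.asHom (χ i r))
    {B : AbelianVariety K} (β : R →+* End B) :
    Module.finrank ℤ (equivariantHom φ β) = ∑ i, Module.finrank ℤ (equivariantHom (χ i) β) := by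
  classical
  -- the two maps
  let Φ : equivariantHom φ β →+ (∀ i, equivariantHom (χ i) β) :=
    { toFun := fun f i ↦ ⟨ι i ≫ f.1, fun r ↦ by
        rw [← Category.assoc, ← hι i r, Category.assoc, f.2 r, Category.assoc]⟩
      map_zero' := by funext i; exact Subtype.ext comp_zero
      map_add' := fun f g ↦ by funext i; exact Subtype.ext (Preadditive.comp_add _ _ _ _ _ _) }
  let Ψ : (∀ i, equivariantHom (χ i) β) →+ equivariantHom φ β :=
    { toFun := fun g ↦ ⟨∑ i, π i ≫ (g i).1, fun r ↦ by
        rw [Preadditive.comp_sum, Preadditive.sum_comp]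
        refine Finset.sum_congr rfl fun i _ ↦ ?_
        rw [← Category.assoc, hπ i r, Category.assoc, (g i).2 r, Category.assoc]⟩
      map_zero' := Subtype.ext (by simp)
      map_add' := fun g g' ↦ Subtype.ext (by
        simp only [Pi.add_apply, Submodule.coe_add, Preadditive.comp_add, Finset.sum_add_distrib]) }
  have hΨΦ : ∀ f, Ψ (Φ f) = N • f := fun f ↦ Subtype.ext (by
    change ∑ i, π i ≫ ι i ≫ f.1 = ((N • f : equivariantHom φ β) : X ⟶ B)
    simp only [← Category.assoc]
    rw [← Preadditive.sum_comp, h3, Preadditive.nsmul_comp, Category.id_comp, Submodule.coe_smul_of_tower])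
  have hΦΨ : ∀ g, Φ (Ψ g) = N • g := fun g ↦ by
    funext j
    apply Subtype.ext
    change ι j ≫ ∑ i, π i ≫ (g i).1 = ((N • g) j : S j ⟶ B)
    rw [Preadditive.comp_sum, Finset.sum_eq_single j, ← Category.assoc, h1,
      Preadditive.nsmul_comp, Category.id_comp, Pi.smul_apply, Submodule.coe_smul_of_tower]
    · intro i _ hij
      rw [← Category.assoc, h2 j i (Ne.symm hij), zero_comp]
    · exact fun h ↦ (h (Finset.mem_univ j)).elim
  rw [finrank_eq_of_nsmul_inverse' Φ Ψ hN.ne' hΨΦ hΦΨ, Module.finrank_pi_fintype]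

end QuasiDecomposition

/-! ## §2 Equivariant isogenies -/

/-- **The quasi-inverse of an equivariant isogeny is equivariant**: if `u : X ⟶ X'` is an
equivariant isogeny (`φ r ≫ u = u ≫ φ' r`) and `u ≫ v = n • 𝟙 X`, then `φ' r ≫ v = v ≫ φ r`
(compose with the epimorphism `u` on the left). [cite: MumfordAV1970, §19 (remark before Thm. 1, p. 169)] -/
theorem equivariant_of_quasiInverse {X X' : AbelianVariety K} (φ : R →+* End X)
    (φ' : R →+* End X') {u : X ⟶ X'} (hu : IsIsogeny u)
    (hue : ∀ r : R, End.asHom (φ r) ≫ u = u ≫ End.asHom (φ' r)) {v : X' ⟶ X} {n : ℕ}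
    (huv : u ≫ v = n • 𝟙 X) (r : R) : End.asHom (φ' r) ≫ v = v ≫ End.asHom (φ r) := by
  haveI := hu.1
  haveI := epi_of_surjective_toSchemeHom u
  rw [← cancel_epi u, ← Category.assoc, ← hue r, Category.assoc, huv, ← Category.assoc, huv,
    Preadditive.nsmul_comp, Preadditive.comp_nsmul, Category.id_comp, Category.comp_id]

/-- **`rank_ℤ Hom_R(X, B) = rank_ℤ Hom_R(X', B)` along an equivariant isogeny `u : X ⟶ X'`**
(pre-composition with `u` and with its equivariant quasi-inverse `v`, inverse to each other up to
`n`). [cite: MumfordAV1970, §19 (remark before Thm. 1, p. 169)] [cite: Milne1986AbelianVarieties, §12 p. 122 (PDF p. 189)] -/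
theorem finrank_equivariantHom_eq_of_isIsogeny_left {X X' : AbelianVariety K} (φ : R →+* End X)
    (φ' : R →+* End X') {u : X ⟶ X'} (hu : IsIsogeny u)
    (hue : ∀ r : R, End.asHom (φ r) ≫ u = u ≫ End.asHom (φ' r))
    {B : AbelianVariety K} (β : R →+* End B) :
    Module.finrank ℤ (equivariantHom φ β) = Module.finrank ℤ (equivariantHom φ' β) := by
  obtain ⟨v, n, hn, huv, hvu⟩ := IsIsogeny.exists_nsmul_inverse_holds hu
  have hve : ∀ r : R, End.asHom (φ' r) ≫ v = v ≫ End.asHom (φ r) :=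
    equivariant_of_quasiInverse φ φ' hu hue huv
  symm
  let Φ : equivariantHom φ' β →+ equivariantHom φ β :=
    { toFun := fun g ↦ ⟨u ≫ g.1, fun r ↦ by
        rw [← Category.assoc, hue r, Category.assoc, g.2 r, Category.assoc]⟩
      map_zero' := Subtype.ext comp_zero
      map_add' := fun g g' ↦ Subtype.ext (Preadditive.comp_add _ _ _ _ _ _) }
  let Ψ : equivariantHom φ β →+ equivariantHom φ' β :=
    { toFun := fun f ↦ ⟨v ≫ f.1, fun r ↦ by
        rw [← Category.assoc, hve r, Category.assoc, f.2 r, Category.assoc]⟩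
      map_zero' := Subtype.ext comp_zero
      map_add' := fun f f' ↦ Subtype.ext (Preadditive.comp_add _ _ _ _ _ _) }
  refine finrank_eq_of_nsmul_inverse' Φ Ψ hn.ne' (fun g ↦ Subtype.ext ?_) (fun f ↦ Subtype.ext ?_)
  · change v ≫ u ≫ g.1 = ((n • g : equivariantHom φ' β) : X' ⟶ B)
    rw [← Category.assoc, hvu, Preadditive.nsmul_comp, Category.id_comp, Submodule.coe_smul_of_tower]
  · change u ≫ v ≫ f.1 = ((n • f : equivariantHom φ β) : X ⟶ B)
    rw [← Category.assoc, huv, Preadditive.nsmul_comp, Category.id_comp, Submodule.coe_smul_of_tower]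

/-- **`Hom_R(S, B)` is `0` or `S ∼_R B`**, granted that every non-zero equivariant `S → B` is an
isogeny (`hSB` — Schur's lemma with operators for `R`-simple `S`, `B`).
[cite: MumfordAV1970, §19 Cor. 2 of Thm. 1 (p. 174)] [cite: LangeRodriguez2022, §2.9] -/
theorem exists_equivariant_isIsogeny_or_equivariantHom_eq_bot {S B : AbelianVariety K}
    (χ : R →+* End S) (β : R →+* End B)
    (hSB : ∀ f : S ⟶ B, (∀ r : R, End.asHom (χ r) ≫ f = f ≫ End.asHom (β r)) → f ≠ 0 →
      IsIsogeny f) :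
    (∃ u : S ⟶ B, IsIsogeny u ∧ ∀ r : R, End.asHom (χ r) ≫ u = u ≫ End.asHom (β r)) ∨
      equivariantHom χ β = ⊥ := by
  by_cases h : equivariantHom χ β = ⊥
  · exact Or.inr h
  · rw [Submodule.eq_bot_iff] at h
    push Not at h
    obtain ⟨f, hf, hf0⟩ := h
    exact Or.inl ⟨f, hSB f hf hf0, hf⟩

/-- `rank_ℤ Hom_R(S, B)` is `rank_ℤ End_R(B)` or `0` according as `S ∼_R B` (an equivariant
isogeny `S → B` exists) or not, granted `hSB`. [cite: Milne1986AbelianVarieties, §12 p. 122 (PDF p. 189)] -/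
theorem finrank_equivariantHom_eq_ite {S B : AbelianVariety K} (χ : R →+* End S)
    (β : R →+* End B)
    (hSB : ∀ f : S ⟶ B, (∀ r : R, End.asHom (χ r) ≫ f = f ≫ End.asHom (β r)) → f ≠ 0 →
      IsIsogeny f)
    [Decidable (∃ u : S ⟶ B, IsIsogeny u ∧ ∀ r : R, End.asHom (χ r) ≫ u = u ≫ End.asHom (β r))] :
    Module.finrank ℤ (equivariantHom χ β) =
      if (∃ u : S ⟶ B, IsIsogeny u ∧ ∀ r : R, End.asHom (χ r) ≫ u = u ≫ End.asHom (β r)) then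
        Module.finrank ℤ (equivariantHom β β) else 0 := by
  split_ifs with h
  · obtain ⟨u, hu, hue⟩ := h
    exact finrank_equivariantHom_eq_of_isIsogeny_left χ β hu hue β
  · rcases exists_equivariant_isIsogeny_or_equivariantHom_eq_bot χ β hSB with h' | h'
    · exact (h h').elim
    · rw [h', finrank_bot]

/-- `rank_ℤ End_R(B) > 0` for `B` of positive dimension (`𝟙 B ∈ End_R(B)` is non-zero).
[cite: Milne1986AbelianVarieties, §12 p. 122 (PDF p. 189)] -/
theorem finrank_equivariantEnd_pos {B : AbelianVariety K} (β : R →+* End B) (hB : 0 < B.dim) :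
    0 < Module.finrank ℤ (equivariantHom β β) := by
  refine (Module.finrank_pos_iff_exists_ne_zero (R := ℤ)).2
    ⟨⟨𝟙 B, fun r ↦ by rw [Category.id_comp, Category.comp_id]⟩, fun h ↦ ?_⟩
  exact id_ne_zero_of_dim_pos hB (congrArg Subtype.val h)

/-! ## §3 The equivariant Hom count and the uniqueness of the multiplicities -/

section Count

variable {X : AbelianVariety K} {I : Type} [Fintype I] {S : I → AbelianVariety K}
  (ι : ∀ i, S i ⟶ X) (π : ∀ i, X ⟶ S i) {N : ℕ}

/-- **The equivariant Hom count**: along an equivariant decomposition `X ~ ⊕ Sᵢ` of `(X, φ)`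
into pieces `(Sᵢ, χᵢ)` and for `(B, β)` such that every non-zero equivariant `Sᵢ → B` is an
isogeny (`hSB`; Schur's lemma with operators when the `Sᵢ` and `B` are `R`-simple),
`rank_ℤ Hom_R(X, B) = #{i : Sᵢ ∼_R B} · rank_ℤ End_R(B)`.
[cite: Milne1986AbelianVarieties, §12 p. 122 (PDF p. 189)] [cite: LangeRodriguez2022, §2.9] -/
theorem finrank_equivariantHom_eq_card_mul (φ : R →+* End X) (χ : ∀ i, R →+* End (S i))
    (hN : 0 < N) (h1 : ∀ i, ι i ≫ π i = N • 𝟙 (S i)) (h2 : ∀ i j, i ≠ j → ι i ≫ π j = 0)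
    (h3 : ∑ i, π i ≫ ι i = N • 𝟙 X)
    (hι : ∀ i (r : R), ι i ≫ End.asHom (φ r) = End.asHom (χ i r) ≫ ι i)
    (hπ : ∀ i (r : R), End.asHom (φ r) ≫ π i = π i ≫ End.asHom (χ i r))
    {B : AbelianVariety K} (β : R →+* End B)
    (hSB : ∀ i (f : S i ⟶ B), (∀ r : R, End.asHom (χ i r) ≫ f = f ≫ End.asHom (β r)) → f ≠ 0 →
      IsIsogeny f) :
    Module.finrank ℤ (equivariantHom φ β) =
      Nat.card {i // ∃ u : S i ⟶ B, IsIsogeny u ∧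
          ∀ r : R, End.asHom (χ i r) ≫ u = u ≫ End.asHom (β r)} *
        Module.finrank ℤ (equivariantHom β β) := by
  classical
  rw [finrank_equivariantHom_eq_sum_of_quasiDecomposition ι π φ χ hN h1 h2 h3 hι hπ β,
    Finset.sum_congr rfl fun i _ ↦ finrank_equivariantHom_eq_ite (χ i) β (hSB i), Finset.sum_ite,
    Finset.sum_const_zero, add_zero, Finset.sum_const, smul_eq_mul, Nat.card_eq_fintype_card,
    Fintype.card_subtype]

/-- **The multiplicities are uniquely determined, with operators**: for equivariant decompositions
`X ~ ⊕ Sᵢ` of `(X, φ)` and `X' ~ ⊕ Tⱼ` of `(X', φ')` linked by an EQUIVARIANT isogeny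
`u : X ⟶ X'`, and any `(B, β)` of positive dimension towards which non-zero equivariant maps from
the pieces are isogenies (`hSB`, `hTB`), the number of `Sᵢ` equivariantly isogenous to `B` equals
the number of `Tⱼ` equivariantly isogenous to `B` (both are `rank Hom_R(X, B) / rank End_R(B)`).
[cite: Milne1986AbelianVarieties, §12 p. 122 (PDF p. 189)] [cite: LangeRodriguez2022, §2.9] -/
theorem card_equivariantlyIsogenous_eq_of_quasiDecompositions (φ : R →+* End X)
    (χ : ∀ i, R →+* End (S i)) (hN : 0 < N)
    (h1 : ∀ i, ι i ≫ π i = N • 𝟙 (S i)) (h2 : ∀ i j, i ≠ j → ι i ≫ π j = 0)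
    (h3 : ∑ i, π i ≫ ι i = N • 𝟙 X)
    (hι : ∀ i (r : R), ι i ≫ End.asHom (φ r) = End.asHom (χ i r) ≫ ι i)
    (hπ : ∀ i (r : R), End.asHom (φ r) ≫ π i = π i ≫ End.asHom (χ i r))
    {X' : AbelianVariety K} (φ' : R →+* End X') {J : Type} [Fintype J]
    {T : J → AbelianVariety K} (τ : ∀ j, R →+* End (T j))
    (ι' : ∀ j, T j ⟶ X') (π' : ∀ j, X' ⟶ T j) {N' : ℕ} (hN' : 0 < N')
    (h1' : ∀ j, ι' j ≫ π' j = N' • 𝟙 (T j)) (h2' : ∀ j j', j ≠ j' → ι' j ≫ π' j' = 0)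
    (h3' : ∑ j, π' j ≫ ι' j = N' • 𝟙 X')
    (hι' : ∀ j (r : R), ι' j ≫ End.asHom (φ' r) = End.asHom (τ j r) ≫ ι' j)
    (hπ' : ∀ j (r : R), End.asHom (φ' r) ≫ π' j = π' j ≫ End.asHom (τ j r))
    {u : X ⟶ X'} (hu : IsIsogeny u) (hue : ∀ r : R, End.asHom (φ r) ≫ u = u ≫ End.asHom (φ' r))
    {B : AbelianVariety K} (β : R →+* End B) (hB : 0 < B.dim)
    (hSB : ∀ i (f : S i ⟶ B), (∀ r : R, End.asHom (χ i r) ≫ f = f ≫ End.asHom (β r)) → f ≠ 0 →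
      IsIsogeny f)
    (hTB : ∀ j (f : T j ⟶ B), (∀ r : R, End.asHom (τ j r) ≫ f = f ≫ End.asHom (β r)) → f ≠ 0 →
      IsIsogeny f) :
    Nat.card {i // ∃ v : S i ⟶ B, IsIsogeny v ∧
        ∀ r : R, End.asHom (χ i r) ≫ v = v ≫ End.asHom (β r)} =
      Nat.card {j // ∃ v : T j ⟶ B, IsIsogeny v ∧
        ∀ r : R, End.asHom (τ j r) ≫ v = v ≫ End.asHom (β r)} := by
  have h := finrank_equivariantHom_eq_of_isIsogeny_left φ φ' hu hue β
  rw [finrank_equivariantHom_eq_card_mul ι π φ χ hN h1 h2 h3 hι hπ β hSB,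
    finrank_equivariantHom_eq_card_mul ι' π' φ' τ hN' h1' h2' h3' hι' hπ' β hTB] at h
  exact Nat.eq_of_mul_eq_mul_right (finrank_equivariantEnd_pos β hB) h

/-- **Each piece is determined up to equivariant isogeny**: in the situation of
`card_equivariantlyIsogenous_eq_of_quasiDecompositions`, granted Schur's lemma with operators
between all the pieces (`hschur`), every piece `S_{i₀}` of positive dimension is equivariantly
isogenous to some `Tⱼ`. [cite: Milne1986AbelianVarieties, §12 p. 122 (PDF p. 189)]
[cite: LangeRodriguez2022, §2.9] -/
theorem exists_equivariantlyIsogenous_piece_of_quasiDecompositions (φ : R →+* End X)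
    (χ : ∀ i, R →+* End (S i)) (hN : 0 < N)
    (h1 : ∀ i, ι i ≫ π i = N • 𝟙 (S i)) (h2 : ∀ i j, i ≠ j → ι i ≫ π j = 0)
    (h3 : ∑ i, π i ≫ ι i = N • 𝟙 X)
    (hι : ∀ i (r : R), ι i ≫ End.asHom (φ r) = End.asHom (χ i r) ≫ ι i)
    (hπ : ∀ i (r : R), End.asHom (φ r) ≫ π i = π i ≫ End.asHom (χ i r))
    {X' : AbelianVariety K} (φ' : R →+* End X') {J : Type} [Fintype J]
    {T : J → AbelianVariety K} (τ : ∀ j, R →+* End (T j))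
    (ι' : ∀ j, T j ⟶ X') (π' : ∀ j, X' ⟶ T j) {N' : ℕ} (hN' : 0 < N')
    (h1' : ∀ j, ι' j ≫ π' j = N' • 𝟙 (T j)) (h2' : ∀ j j', j ≠ j' → ι' j ≫ π' j' = 0)
    (h3' : ∑ j, π' j ≫ ι' j = N' • 𝟙 X')
    (hι' : ∀ j (r : R), ι' j ≫ End.asHom (φ' r) = End.asHom (τ j r) ≫ ι' j)
    (hπ' : ∀ j (r : R), End.asHom (φ' r) ≫ π' j = π' j ≫ End.asHom (τ j r))
    {u : X ⟶ X'} (hu : IsIsogeny u) (hue : ∀ r : R, End.asHom (φ r) ≫ u = u ≫ End.asHom (φ' r))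
    (i₀ : I) (hi₀ : 0 < (S i₀).dim)
    (hSB : ∀ i (f : S i ⟶ S i₀), (∀ r : R, End.asHom (χ i r) ≫ f = f ≫ End.asHom (χ i₀ r)) →
      f ≠ 0 → IsIsogeny f)
    (hTB : ∀ j (f : T j ⟶ S i₀), (∀ r : R, End.asHom (τ j r) ≫ f = f ≫ End.asHom (χ i₀ r)) →
      f ≠ 0 → IsIsogeny f) :
    ∃ (j : J) (v : T j ⟶ S i₀), IsIsogeny v ∧
      ∀ r : R, End.asHom (τ j r) ≫ v = v ≫ End.asHom (χ i₀ r) := by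
  classical
  have hcard := card_equivariantlyIsogenous_eq_of_quasiDecompositions ι π φ χ hN h1 h2 h3 hι hπ
    φ' τ ι' π' hN' h1' h2' h3' hι' hπ' hu hue (χ i₀) hi₀ hSB hTB
  have hpos : 0 < Nat.card {i // ∃ v : S i ⟶ S i₀, IsIsogeny v ∧
      ∀ r : R, End.asHom (χ i r) ≫ v = v ≫ End.asHom (χ i₀ r)} := by
    haveI : Nonempty {i // ∃ v : S i ⟶ S i₀, IsIsogeny v ∧
        ∀ r : R, End.asHom (χ i r) ≫ v = v ≫ End.asHom (χ i₀ r)} :=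
      ⟨⟨i₀, 𝟙 _, isIsogeny_id _, fun r ↦ by rw [Category.id_comp, Category.comp_id]⟩⟩
    exact Nat.card_pos
  rw [hcard] at hpos
  obtain ⟨⟨j, v, hv, hve⟩⟩ := (Nat.card_pos_iff.1 hpos).1
  exact ⟨j, v, hv, hve⟩

end Count

end AbelianVariety

end Literature.AlgebraicGeometry.Motives

end
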